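import Mathlib

/-!
# The incoming-node theorem for sub-Leray self-similar Euler collapse: the typed skeleton

Solo seat `solo-NavierStokesRegularity-informed` (session 7; paper §3.3 and the self-contained note
`paper/incoming-stagnation.md`, CLAIMS C40–C41). Context for Clay (A): a first Navier–Stokes
singularity collapsing at spatial rate `(T-t)^γ` needs `2/5 ≤ γ ≤ 1/2` (finite energy; `ν > 0`, cf.
`collapseRate_le_half`), and for `γ < 1/2` viscosity is asymptotically invisible, so the negative
programme in that window is an Euler self-similar profile shadowed by Navier–Stokes.

THEOREM A′ (proved by hand in the note; NOT formalised here). For `0 < γ < 1/2`, every `C¹` profile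
`U` of the self-similar Euler equations `(1-γ)U + γ(y·∇)U + (U·∇)U + ∇P = 0`, `div U = 0`, with
`|U(y)| = o(|y|)`, `P` bounded above and `curl U ≢ 0`, has a stagnation point `y*` of the similarity
velocity `V = γ y + U` with `λ_min(sym ∇V(y*)) ≤ 2γ - 1 < 0`: some material direction through `y*` is
compressed at linear rate `≥ 1 - 2γ`. (This sharpens Constantin–Ignatova–Vicol, arXiv:2602.17570,
Thm 3.10: no real-analyticity, no finiteness of the nodal set.) Proof: backward `V`-trajectories are
trapped in compact superlevel sets of the Bernoulli function (pointwise law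
`Literature…ConstantinIgnatovaVicol2026.bernoulliTransport_pointwise`, filed separately); a loop with
circulation `Γ₀ ≠ 0` has, by the self-similar Kelvin law, `|Γ(-σ)| = e^{(1-2γ)σ}|Γ₀|`; but
`|Γ(-σ)| ≤ M · L · J(σ)` with `M = max |U|` on the trapping set, `L` the initial length and `J(σ)` the
maximal backward Jacobian norm, and `J(σ) ≤ C_ε e^{(μ* + ε)σ}` for every `ε > 0`, where
`μ* = max over the nodes of λ_max(-sym ∇V)` (Jacobian ODE + the uniform time budget away from the
nodes). WHAT IS FORMALISED HERE is exactly the concluding bookkeeping, which is where the only error of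
the hand derivation occurred (the inequality is NON-strict, so corollaries need a margin `ε > 0`):
`rate_le_of_exp_dominated` (comparison of exponential rates), `incomingRate_le_of_kelvin_stretching`
(Steps 3–6 ⇒ `1 - 2γ ≤ μ*`, with the `ε`-margin handled by `le_of_forall_pos_le_add`),
`minEig_le_of_incomingRate` (translation `μ* = -(γ + λ_min S)` ⇒ `λ_min S ≤ γ - 1`,
`λ_min sym∇V ≤ 2γ - 1`), `maxEig_ge_of_divergence` (since `tr sym ∇V = 3γ`, the incoming node is a
saddle with expanding rate `≥ (γ+1)/2`), and `no_contradiction_at_zero_margin` (the equality case is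
consistent, so "every node non-incoming with margin 0" is NOT excluded by the theorem). Elementary.
[new combination of [ConstantinIgnatovaVicol2026Euler] §3 with a Jacobian-growth estimate; the question it
addresses is posed in Ginibre–Le Berre–Pomeau, arXiv:1904.02387, p. 8]
-/

namespace Summit.NavierStokesRegularity.NavierStokesRegularity.Theorems

/-- **Comparison of exponential rates.** If `c e^{aσ} ≤ C e^{bσ}` for all `σ ≥ 0` with `c > 0`,
then `a ≤ b`. (Step 6 of Theorem A′.) -/
theorem rate_le_of_exp_dominated {a b c C : ℝ} (hc : 0 < c)
    (h : ∀ σ : ℝ, 0 ≤ σ → c * Real.exp (a * σ) ≤ C * Real.exp (b * σ)) : a ≤ b := by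
  by_contra hab
  have hab' : b < a := lt_of_not_ge hab
  have hdpos : 0 < a - b := by linarith
  have hcd : 0 < c * (a - b) := mul_pos hc hdpos
  set σ := |C| / (c * (a - b)) + 1 with hσ
  have hσ0 : 0 ≤ σ := by positivity
  have key := h σ hσ0
  have hexp : Real.exp (a * σ) = Real.exp ((a - b) * σ) * Real.exp (b * σ) := by
    rw [← Real.exp_add]; congr 1; ring
  rw [hexp, ← mul_assoc] at key
  have hb : 0 < Real.exp (b * σ) := Real.exp_pos _
  have key2 : c * Real.exp ((a - b) * σ) ≤ C := le_of_mul_le_mul_right key hb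
  have hlin : (a - b) * σ + 1 ≤ Real.exp ((a - b) * σ) := Real.add_one_le_exp _
  have h3 : c * ((a - b) * σ + 1) ≤ C := le_trans (mul_le_mul_of_nonneg_left hlin hc.le) key2
  have h4 : c * (a - b) * σ = |C| + c * (a - b) := by
    rw [hσ]; field_simp
  have hC : C ≤ |C| := le_abs_self C
  nlinarith

/-- **Steps 3–6 of Theorem A′, abstract form.** `Γ σ` is the circulation of the loop transported
backward for time `σ`, `J σ` the maximal norm of the backward Jacobian over the loop. Kelvin's
self-similar law (`hK`), the trivial bound of a line integral by `sup |U| · length · stretching`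
(`hB`), and the stretching estimate near the nodes with an arbitrary margin `ε > 0` (`hS`) force
`1 - 2γ ≤ μ`, where `μ` stands for `max_{nodes} λ_max(-sym ∇V)`. -/
theorem incomingRate_le_of_kelvin_stretching {γ μ Γ₀ M L : ℝ} (Γ J : ℝ → ℝ) (hΓ₀ : Γ₀ ≠ 0)
    (hM : 0 ≤ M) (hL : 0 ≤ L)
    (hK : ∀ σ : ℝ, 0 ≤ σ → |Γ σ| = Real.exp ((1 - 2 * γ) * σ) * |Γ₀|)
    (hB : ∀ σ : ℝ, 0 ≤ σ → |Γ σ| ≤ M * L * J σ)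
    (hS : ∀ ε : ℝ, 0 < ε → ∃ C : ℝ, ∀ σ : ℝ, 0 ≤ σ → J σ ≤ C * Real.exp ((μ + ε) * σ)) :
    1 - 2 * γ ≤ μ := by
  refine le_of_forall_pos_le_add fun ε hε => ?_
  obtain ⟨C, hC⟩ := hS ε hε
  have hML : 0 ≤ M * L := mul_nonneg hM hL
  refine rate_le_of_exp_dominated (abs_pos.mpr hΓ₀) (C := M * L * C) fun σ hσ => ?_
  calc |Γ₀| * Real.exp ((1 - 2 * γ) * σ) = |Γ σ| := by rw [hK σ hσ, mul_comm]
    _ ≤ M * L * J σ := hB σ hσ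
    _ ≤ M * L * (C * Real.exp ((μ + ε) * σ)) := mul_le_mul_of_nonneg_left (hC σ hσ) hML
    _ = M * L * C * Real.exp ((μ + ε) * σ) := by ring

/-- Translation to the strain at the node: with `μ = λ_max(-sym ∇V(y*)) = -(γ + s)`, `s = λ_min(sym ∇U(y*))`,
the bound `1 - 2γ ≤ μ` reads `s ≤ γ - 1`, i.e. `λ_min(sym ∇V(y*)) = γ + s ≤ 2γ - 1`. -/
theorem minEig_le_of_incomingRate {γ μ s : ℝ} (hμ : μ = -(γ + s)) (h : 1 - 2 * γ ≤ μ) :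
    s ≤ γ - 1 ∧ γ + s ≤ 2 * γ - 1 := by
  subst hμ; constructor <;> linarith

/-- The incoming node is a saddle of the similarity flow: `tr sym ∇V(y*) = 3γ` (from `div U = 0`) and
`λ₁ ≤ 2γ - 1` force the largest eigenvalue to be `≥ (γ + 1)/2 > 0`. -/
theorem maxEig_ge_of_divergence {γ l₁ l₂ l₃ : ℝ} (htr : l₁ + l₂ + l₃ = 3 * γ) (h₁ : l₁ ≤ 2 * γ - 1)
    (h₂₃ : l₂ ≤ l₃) : (γ + 1) / 2 ≤ l₃ := by linarith

/-- In the window `0 < γ < 1/2` the compressive rate is positive and the node is genuinely hyperbolic: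
`2γ - 1 < 0 < (γ+1)/2`. -/
theorem window_rates {γ : ℝ} (h₀ : 0 < γ) (h₁ : γ < 1 / 2) : 2 * γ - 1 < 0 ∧ 0 < (γ + 1) / 2 := by
  constructor <;> linarith

/-- The margin is necessary: from `1 - 2γ ≤ μ` and `μ ≤ 1 - 2γ` (every node non-incoming with margin
zero) no contradiction follows — witnessed by `μ = 1 - 2γ`. Corollaries excluding profiles therefore
assume `sym ∇V(y*) ⪰ (2γ - 1 + ε) I` at all nodes for some `ε > 0` (outgoing nodes: margin `1 - 2γ`). -/
theorem no_contradiction_at_zero_margin :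
    ¬ (∀ μ γ : ℝ, 1 - 2 * γ ≤ μ → μ ≤ 1 - 2 * γ → False) := by
  intro h; exact h 1 0 (by norm_num) (by norm_num)

end Summit.NavierStokesRegularity.NavierStokesRegularity.Theorems
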